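import Summits.QuantumFields.YangMills.Theorems.SmallCircleAnchorAnchorGapStubDebyeScreening24

/-!
# Crux `AnchorGap` (stmt-QuantumFields-11141), line `registered` — local zero-mode cut-off

The `ε = 0` cell ensemble of stub X₀ integrates `Λ'`-periodic functionals (`Λ' = Σ_j ℤ b_j`, acting
by constant shifts of the field) over the sharp fundamental cell `S = {θ̄(φ) ∈ b·[0,1)^k}` of the
GLOBAL zero mode `θ̄(φ) = V⁻¹ Σ_x φ(x)`.  A cluster expansion cannot carry a global constraint; the
sharp indicator `1_S` can be traded for `ρ(A φ)`, where `ρ` is any partition of unity of `ℝ^k`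
along `Λ'` and `A` is ANY measurable functional equivariant under the constant shifts
(`A(φ + w_n) = A φ + w_n`, e.g. the average of `φ` over a single block):

* `stub_localZeroModeCutoff` — `∫ ρ(A φ) I(φ) dφ = ∫ 1_S I` for `Λ'`-periodic measurable `I` with
  `1_S I` integrable (unfolding over the fundamental domain `S` of the free measure-preserving
  `ℤ^k`-action by constant shifts, `IsAddFundamentalDomain.integral_eq_tsum''`, equivariance of `A`,
  and resummation of `ρ` along each orbit).  The special case `A = θ̄` is
  `integral_zeroMode_partition`.
-/

set_option autoImplicit false

noncomputable section

namespace Summit.QuantumFields.YangMills.Theorems.AnchorGap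

open MeasureTheory Finset
open Literature.Probability.LatticeModels

/-- **Local zero-mode cut-off: unfolding the cell constraint against a partition of unity evaluated
on an equivariant functional.** Let `b` be a basis of `ℝ^k`, `w_n = Σ_j n_j b_j` (`n ∈ ℤ^k`), `S`
the set of configurations whose global zero-mode average lies in the half-open cell `b·[0,1)^k`,
`I` a measurable functional invariant under the constant shifts `φ ↦ φ + w_n` with `1_S I`
integrable, `A : Config → ℝ^k` measurable and equivariant (`A(φ + w_n) = A φ + w_n`), and `ρ ≥ 0`
measurable on `ℝ^k` with `Σ_n ρ(θ + w_n) = 1` for every `θ`.  Then `∫ ρ(A φ) I(φ) dφ = ∫ 1_S I dφ`: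
`S` is a fundamental domain of the free volume-preserving `ℤ^k`-action, so
`∫ ρ(A φ) I = Σ_n ∫_S ρ(A φ + w_n) I(φ) = ∫_S I · Σ_n ρ(A φ + w_n) = ∫_S I`. [folklore] -/
theorem stub_localZeroModeCutoff : ∀ (d N k : ℕ) [NeZero N] (b : Fin k → Fin k → ℝ), LinearIndependent ℝ b → ∀ (I : LatticeSineGordon.Config d N k → ℝ), Measurable I → (∀ (φ : LatticeSineGordon.Config d N k) (n : Fin k → ℤ), I (fun p => φ p + ∑ j : Fin k, (n j : ℝ) * b j p.2) = I φ) → Integrable ({φ : LatticeSineGordon.Config d N k | ∃ t : Fin k → ℝ, (∀ j : Fin k, 0 ≤ t j ∧ t j < 1) ∧ ∀ a : Fin k, (Fintype.card (TorusSite d N) : ℝ)⁻¹ * ∑ x : TorusSite d N, φ (x, a) = ∑ j : Fin k, t j * b j a}.indicator I) → ∀ (A : LatticeSineGordon.Config d N k → (Fin k → ℝ)), Measurable A → (∀ (φ : LatticeSineGordon.Config d N k) (n : Fin k → ℤ), A (fun p => φ p + ∑ j : Fin k, (n j : ℝ) * b j p.2) = fun c => A φ c + ∑ j : Fin k, (n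 j : ℝ) * b j c) → ∀ (ρ : (Fin k → ℝ) → ℝ), Measurable ρ → (∀ θ : Fin k → ℝ, 0 ≤ ρ θ) → (∀ θ : Fin k → ℝ, Summable (fun n : Fin k → ℤ => ρ (θ + fun c => ∑ j : Fin k, (n j : ℝ) * b j c)) ∧ ∑' n : Fin k → ℤ, ρ (θ + fun c => ∑ j : Fin k, (n j : ℝ) * b j c) = 1) → ∫ φ : LatticeSineGordon.Config d N k, ρ (A φ) * I φ = ∫ φ : LatticeSineGordon.Config d N k, {φ : LatticeSineGordon.Config d N k | ∃ t : Fin k → ℝ, (∀ j : Fin k, 0 ≤ t j ∧ t j < 1) ∧ ∀ a : Fin k, (Fintype.card (TorusSite d N) : ℝ)⁻¹ * ∑ x : TorusSite d N, φ (x, a) = ∑ j : Fin k, t j * b j a}.indicator I φ := by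
  intro d N k _ b hb I hIm hIper hIS A hAm hAeq ρ hρm hρ0 hρ1
  classical
  -- adapted from `integral_zeroMode_partition` (the special case `A = θ̄`, the global zero mode)
  -- notation: volume `V`, lattice vectors `w n`, zero mode `θb`
  set V : ℝ := (Fintype.card (TorusSite d N) : ℝ) with hV
  have hVpos : 0 < V := by
    rw [hV]; exact_mod_cast Fintype.card_pos
  have hVne : V ≠ 0 := hVpos.ne'
  set w : (Fin k → ℤ) → Fin k → ℝ := fun n c => ∑ j, (n j : ℝ) * b j c with hw
  set θb : LatticeSineGordon.Config d N k → Fin k → ℝ := fun φ c => V⁻¹ * ∑ x, φ (x, c) with hθb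
  set S : Set (LatticeSineGordon.Config d N k) := {φ | ∃ t : Fin k → ℝ, (∀ j : Fin k, 0 ≤ t j ∧ t j < 1) ∧
    ∀ a : Fin k, V⁻¹ * ∑ x : TorusSite d N, φ (x, a) = ∑ j : Fin k, t j * b j a} with hS
  -- the basis and its fundamental cell
  let B := basisOfPiSpaceOfLinearIndependent hb
  have hB : ⇑B = b := coe_basisOfPiSpaceOfLinearIndependent hb
  let L : Submodule ℤ (Fin k → ℝ) := Submodule.span ℤ (Set.range B)
  let e : (Fin k → ℤ) ≃ L := (B.restrictScalars ℤ).equivFun.symm.toEquiv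
  have he : ∀ n : Fin k → ℤ, ((e n : L) : Fin k → ℝ) = w n := by
    intro n
    simp only [e, LinearEquiv.coe_toEquiv, Module.Basis.equivFun_symm_apply, hw]
    rw [Submodule.coe_sum]
    funext c
    simp [Module.Basis.restrictScalars_apply, ← hB, zsmul_eq_mul, Finset.sum_apply]
  have hD : ∀ θ : Fin k → ℝ, (∃ t : Fin k → ℝ, (∀ j : Fin k, 0 ≤ t j ∧ t j < 1) ∧
      ∀ a : Fin k, θ a = ∑ j : Fin k, t j * b j a) ↔ θ ∈ ZSpan.fundamentalDomain B := by
    intro θ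
    rw [ZSpan.mem_fundamentalDomain]
    constructor
    · rintro ⟨t, ht, hθt⟩ i
      have hθ : θ = ∑ j, t j • B j := by
        funext a
        rw [hθt a, Finset.sum_apply]
        simp [hB, smul_eq_mul]
      rw [hθ, Module.Basis.repr_sum_self]
      exact ⟨(ht i).1, (ht i).2⟩
    · intro h
      refine ⟨fun j => B.repr θ j, fun j => ⟨(h j).1, (h j).2⟩, fun a => ?_⟩
      conv_lhs => rw [← B.sum_repr θ]
      rw [Finset.sum_apply]
      simp [hB, smul_eq_mul]
  have hSpre : S = θb ⁻¹' ZSpan.fundamentalDomain B := by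
    ext φ
    simp only [hS, Set.mem_setOf_eq, Set.mem_preimage]
    exact hD (θb φ)
  have hθb_cont : Continuous θb := by
    rw [hθb]; fun_prop
  have hSmeas : MeasurableSet S := by
    rw [hSpre]
    exact measurableSet_preimage hθb_cont.measurable (ZSpan.fundamentalDomain_measurableSet B)
  -- the action of `ℤᵏ` on configurations by constant dual-lattice shifts
  letI act : AddAction (Fin k → ℤ) (LatticeSineGordon.Config d N k) :=
    { vadd := fun n φ => fun p => φ p + w n p.2
      zero_vadd := fun φ => by
        funext p
        show φ p + w 0 p.2 = φ p
        simp [hw]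
      add_vadd := fun m n φ => by
        funext p
        show φ p + w (m + n) p.2 = (φ p + w n p.2) + w m p.2
        simp only [hw, Pi.add_apply, Int.cast_add, add_mul, sum_add_distrib]
        ring }
  have hvadd : ∀ (n : Fin k → ℤ) (φ : LatticeSineGordon.Config d N k),
      n +ᵥ φ = fun p => φ p + w n p.2 := fun _ _ => rfl
  have hvadd' : ∀ (n : Fin k → ℤ), (fun φ : LatticeSineGordon.Config d N k => n +ᵥ φ) =
      fun φ => φ + fun p => w n p.2 := fun n => rfl
  haveI : MeasurableConstVAdd (Fin k → ℤ) (LatticeSineGordon.Config d N k) :=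
    ⟨fun n => by rw [hvadd']; exact measurable_add_const _⟩
  haveI hri : (volume : Measure (LatticeSineGordon.Config d N k)).IsAddRightInvariant := by
    rw [volume_pi]; exact Measure.pi.isAddRightInvariant _
  haveI : VAddInvariantMeasure (Fin k → ℤ) (LatticeSineGordon.Config d N k) volume :=
    ⟨fun n s _ => by rw [hvadd']; exact measure_preimage_add_right _ _ _⟩
  -- zero mode of a shifted configuration
  have hθvadd : ∀ (n : Fin k → ℤ) (φ : LatticeSineGordon.Config d N k), θb (n +ᵥ φ) = θb φ + w n := by
    intro n φ
    funext c
    simp only [hθb, hvadd, Pi.add_apply, sum_add_distrib, sum_const, card_univ, nsmul_eq_mul]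
    rw [← hV]
    field_simp
  -- the equivariant functional of a shifted configuration
  have hAvadd : ∀ (n : Fin k → ℤ) (φ : LatticeSineGordon.Config d N k), A (n +ᵥ φ) = A φ + w n := by
    intro n φ
    rw [hvadd]
    exact hAeq φ n
  -- `S` is a fundamental domain
  have hfd : IsAddFundamentalDomain (Fin k → ℤ) S volume := by
    refine IsAddFundamentalDomain.mk' hSmeas.nullMeasurableSet fun φ => ?_
    have hex := ZSpan.exist_unique_vadd_mem_fundamentalDomain B (θb φ)
    rw [hSpre]
    refine (e.existsUnique_congr fun n => ?_).2 hex
    rw [Set.mem_preimage, hθvadd, Submodule.vadd_def, vadd_eq_add, he, add_comm]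
  -- the integrand and its shifts
  set f : LatticeSineGordon.Config d N k → ℝ := fun φ => ρ (A φ) * I φ with hf
  have hfshift : ∀ (n : Fin k → ℤ) (φ : LatticeSineGordon.Config d N k), f (n +ᵥ φ) = ρ (A φ + w n) * I φ := by
    intro n φ
    rw [hf]
    simp only []
    rw [hAvadd, hvadd, hIper φ n]
  have hf_meas : Measurable f := (hρm.comp hAm).mul hIm
  have hterm_meas : ∀ n : Fin k → ℤ, Measurable fun φ : LatticeSineGordon.Config d N k => ρ (A φ + w n) * I φ :=
    fun n => (hρm.comp (hAm.add_const _)).mul hIm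
  -- the orbit sums of the absolute values refold to `∫_S |I|`
  have hIS' : IntegrableOn I S volume := by
    rw [← integrable_indicator_iff hSmeas]; exact hIS
  have hlin : ∀ φ : LatticeSineGordon.Config d N k,
      ∑' n : Fin k → ℤ, ‖ρ (A φ + w n) * I φ‖ₑ = ‖I φ‖ₑ := by
    intro φ
    obtain ⟨hsum, hone⟩ := hρ1 (A φ)
    have h1 : ∀ n : Fin k → ℤ, ‖ρ (A φ + w n) * I φ‖ₑ = ENNReal.ofReal (ρ (A φ + w n)) * ‖I φ‖ₑ := by
      intro n
      rw [enorm_mul, Real.enorm_eq_ofReal (hρ0 _)]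
    simp_rw [h1]
    rw [ENNReal.tsum_mul_right, ← ENNReal.ofReal_tsum_of_nonneg (fun n => hρ0 _) hsum]
    have hw' : (fun n : Fin k → ℤ => ρ (A φ + w n)) = fun n => ρ (A φ + fun c => ∑ j : Fin k, (n j : ℝ) * b j c) := by
      funext n; rfl
    rw [hw', hone, ENNReal.ofReal_one, one_mul]
  have hF_sum : ∑' n : Fin k → ℤ, ∫⁻ φ in S, ‖ρ (A φ + w n) * I φ‖ₑ ≠ ⊤ := by
    rw [← lintegral_tsum fun n => ((hterm_meas n).enorm).aemeasurable]
    simp_rw [hlin]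
    exact hIS'.2.ne
  -- integrability of `f` on the whole space
  have hf_int : Integrable f := by
    refine ⟨hf_meas.aestronglyMeasurable, ?_⟩
    rw [HasFiniteIntegral, hfd.lintegral_eq_tsum'' (fun φ => ‖f φ‖ₑ)]
    simp_rw [hfshift]
    exact lt_top_iff_ne_top.2 hF_sum
  -- unfold, resum `ρ` along each orbit, refold
  rw [hfd.integral_eq_tsum'' f hf_int]
  simp_rw [hfshift]
  rw [← integral_tsum (fun n => (hterm_meas n).aestronglyMeasurable) hF_sum]
  rw [← integral_indicator hSmeas]
  refine integral_congr_ae (Filter.Eventually.of_forall fun φ => ?_)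
  by_cases hφ : φ ∈ S
  · rw [Set.indicator_of_mem hφ, Set.indicator_of_mem hφ, tsum_mul_right]
    obtain ⟨-, hone⟩ := hρ1 (A φ)
    have hw' : (fun n : Fin k → ℤ => ρ (A φ + w n)) = fun n => ρ (A φ + fun c => ∑ j : Fin k, (n j : ℝ) * b j c) := by
      funext n; rfl
    rw [hw', hone, one_mul]
  · rw [Set.indicator_of_notMem hφ, Set.indicator_of_notMem hφ]

end Summit.QuantumFields.YangMills.Theorems.AnchorGap

end
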